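import Mathlib
import HarnessLib
import Summits.HubbardSuperconductivity.HubbardSuperconductivity.Theorems.ComplexGFFStiffnessHypACumulantHolomorphicFamilies

/-!
# Crux `HypACumulant`, line `gnv` — holomorphic families of FINITELY smooth functionals:
# Taylor coefficients up to the order of smoothness are holomorphic in the parameter

Route `route-HubbardSuperconductivity-ComplexGFFStiffness`, cruxes stmt-HubbardSuperconductivity-19154 /
-19155, shared research statement `OnePointLipschitz`, census (C3d′)/(H1).  The activities of the
renormalisation-group flow are only `C^{r₀}` in the field ([ABKM19] Def. 13.7, the space `E_{ζ,𝒬}` of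
Sec. 2.1), so the `C^∞` hypothesis of `…HolomorphicFamilies.differentiableOn_iteratedFDeriv_apply_of_holomorphic`
must be relaxed to the order actually available:

* **`differentiableOn_iteratedFDeriv_apply_of_holomorphic_of_contDiff`** — if `F : ℂ × E → ℂ` is jointly
  `C^n` (real sense, `n : ℕ`) and `σ ↦ F(σ, y)` is holomorphic on the open set `U` for every `y`, then for
  every `s ≤ n`, every `y` and directions `v`, the Taylor coefficient `σ ↦ D^s_y F(σ,·)(y)(v)` is holomorphic
  on `U` and jointly `C^{n−s}` in `(σ, y)`.  Same induction as the `C^∞` version, with the order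
  bookkeeping `C^{n−s} → C^{n−s−1}` of `ContDiff.fderiv_apply`; the one-variable engine
  `differentiableOn_partialDeriv_of_holomorphic` only needs joint `C¹`.

Pure analysis; all proved, no `sorry`.

## References
* S. Adams, S. Buchholz, R. Kotecký, S. Müller, arXiv:1910.13564, Definition 13.7, Ch. 10–11
  [AdamsBuchholzKoteckyMuller2019].
-/

noncomputable section

-- `Summit.<Summit>.<Problem>`: single-conjunct summit, the duplicate component is mandated (D-0017).
set_option linter.dupNamespace false

namespace Summit.HubbardSuperconductivity.HubbardSuperconductivity.Theorems.ComplexGFF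

open Metric Set Filter Topology

variable {E : Type*} [NormedAddCommGroup E] [NormedSpace ℝ E]

/-- **Holomorphic families of `C^n` functionals have holomorphic Taylor coefficients up to order `n`.** -/
theorem differentiableOn_iteratedFDeriv_apply_of_holomorphic_of_contDiff {U : Set ℂ} (hU : IsOpen U)
    {F : ℂ × E → ℂ} {n : ℕ} (hF : ContDiff ℝ (n : WithTop ℕ∞) F)
    (hhol : ∀ y : E, DifferentiableOn ℂ (fun σ => F (σ, y)) U) (s : ℕ) (hs : s ≤ n) :
    ∀ v : Fin s → E,
      ContDiff ℝ ((n - s : ℕ) : WithTop ℕ∞) (fun p : ℂ × E => iteratedFDeriv ℝ s (fun y => F (p.1, y)) p.2 v) ∧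
      ∀ y : E, DifferentiableOn ℂ (fun σ => iteratedFDeriv ℝ s (fun y => F (σ, y)) y v) U := by
  induction s with
  | zero =>
    intro v
    have e : ∀ (σ : ℂ) (y : E), iteratedFDeriv ℝ 0 (fun y => F (σ, y)) y v = F (σ, y) := fun σ y =>
      iteratedFDeriv_zero_apply v
    refine ⟨?_, fun y => ?_⟩
    · simp only [e, Nat.sub_zero]
      exact hF
    · simp only [e]
      exact hhol y
  | succ s ih =>
    intro v
    have hs' : s ≤ n := Nat.le_of_succ_le hs
    obtain ⟨hsmooth, hholo⟩ := ih hs' (Fin.tail v)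
    have hns1 : 1 ≤ n - s := by omega
    set g : ℂ × E → ℂ := fun p => iteratedFDeriv ℝ s (fun y => F (p.1, y)) p.2 (Fin.tail v) with hg
    have hFσ : ∀ σ : ℂ, ContDiff ℝ (n : WithTop ℕ∞) (fun y : E => F (σ, y)) := fun σ =>
      hF.comp ((contDiff_const (c := σ)).prodMk contDiff_id)
    -- the key identity `D^{s+1} F(σ,·)(y)(v) = fderiv (g(σ,·)) y (v 0)`
    have hkey : ∀ (σ : ℂ) (y : E), iteratedFDeriv ℝ (s + 1) (fun y => F (σ, y)) y v = fderiv ℝ (fun y => g (σ, y)) y (v 0) := by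
      intro σ y
      rw [iteratedFDeriv_succ_apply_left]
      have hlt : (s : WithTop ℕ∞) < (n : WithTop ℕ∞) := by exact_mod_cast (Nat.lt_of_succ_le hs)
      have hd : DifferentiableAt ℝ (iteratedFDeriv ℝ s (fun y => F (σ, y))) y :=
        ((hFσ σ).differentiable_iteratedFDeriv hlt) y
      have hcomp : fderiv ℝ (fun y => g (σ, y)) y =
          (ContinuousMultilinearMap.apply ℝ (fun _ : Fin s => E) ℂ (Fin.tail v)).comp
            (fderiv ℝ (iteratedFDeriv ℝ s (fun y => F (σ, y))) y) := by
        have h := ((ContinuousMultilinearMap.apply ℝ (fun _ : Fin s => E) ℂ (Fin.tail v)).hasFDerivAt.comp y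
          hd.hasFDerivAt).fderiv
        simpa [hg, Function.comp_def] using h
      rw [hcomp]
      rfl
    -- joint `C^{n−s−1}` of the new coefficient
    have horder : (((n - (s + 1) : ℕ) : WithTop ℕ∞)) + 1 ≤ ((n - s : ℕ) : WithTop ℕ∞) := by
      have : n - (s + 1) + 1 = n - s := by omega
      exact_mod_cast this.le
    have hsmooth' : ContDiff ℝ ((n - (s + 1) : ℕ) : WithTop ℕ∞)
        (fun p : ℂ × E => fderiv ℝ (fun y => g (p.1, y)) p.2 (v 0)) := by
      have hunc : ContDiff ℝ ((n - s : ℕ) : WithTop ℕ∞) (Function.uncurry fun (p : ℂ × E) (y : E) => g (p.1, y)) := by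
        have e : (Function.uncurry fun (p : ℂ × E) (y : E) => g (p.1, y)) = g ∘ (fun q : (ℂ × E) × E => (q.1.1, q.2)) := by
          funext q; rfl
        rw [e]
        exact hsmooth.comp ((contDiff_fst.comp contDiff_fst).prodMk contDiff_snd)
      exact hunc.fderiv_apply contDiff_snd contDiff_const horder
    refine ⟨?_, fun y => ?_⟩
    · have e : (fun p : ℂ × E => iteratedFDeriv ℝ (s + 1) (fun y => F (p.1, y)) p.2 v)
          = fun p => fderiv ℝ (fun y => g (p.1, y)) p.2 (v 0) := by
        funext p; exact hkey p.1 p.2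
      rw [e]; exact hsmooth'
    · have h1le : (1 : WithTop ℕ∞) ≤ ((n - s : ℕ) : WithTop ℕ∞) := by exact_mod_cast hns1
      have hgy : ∀ σ : ℂ, DifferentiableAt ℝ (fun y => g (σ, y)) y := fun σ =>
        ((hsmooth.comp ((contDiff_const (c := σ)).prodMk contDiff_id)).differentiable
          (ne_of_gt (lt_of_lt_of_le zero_lt_one h1le))) y
      have e : ∀ σ : ℂ, iteratedFDeriv ℝ (s + 1) (fun y => F (σ, y)) y v
          = deriv (fun t : ℝ => g (σ, y + t • (v 0))) 0 := by
        intro σ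
        rw [hkey, fderiv_apply_eq_deriv_line (hgy σ)]
      have hG : ContDiff ℝ ((n - s : ℕ) : WithTop ℕ∞) (fun q : ℂ × ℝ => g (q.1, y + q.2 • (v 0))) :=
        hsmooth.comp (contDiff_fst.prodMk ((contDiff_const.add (contDiff_snd.smul contDiff_const))))
      have hGhol : ∀ t : ℝ, DifferentiableOn ℂ (fun σ => g (σ, y + t • (v 0))) U := fun t => hholo _
      have h := differentiableOn_partialDeriv_of_holomorphic hU hG h1le hGhol 0
      refine (h.congr (fun σ _ => ?_))
      exact e σ

end Summit.HubbardSuperconductivity.HubbardSuperconductivity.Theorems.ComplexGFF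

end
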